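import Summits.CriticalPhenomena.Ising3DConformalLimit.Theorems.EnergyNotSigmaSquaredRungOneAdjacentMergingAbstractHarvestAux
import Mathlib.Algebra.Field.GeomSum
import HarnessLib

/-!
# Abstract share harvest, part 2: the greedy decay-separation chain and its block maxima
(stub `stub_abstractHarvest` of the line `dominant-shell-concentration`, crux `RungOneAdjacentMerging`,
item stmt-CriticalPhenomena-11262; lead prover-line-stmt-CriticalPhenomena-11262-0)

Sequel to `…AbstractHarvestAux` (divergence of the windowed shares).  Fix `HarvestData a B`, the share
`sh k = 8^k a(k+2)²/B(k+1)`, the window predicate `W k ⇔ a(k-4) ≤ 2^128·a(k+4)` and a decay factor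
`0 < τ ≤ 1/2`.  A BLOCK SEQUENCE (`Blocks a τ m`) is a greedy chain `m 0 < m 1 < …` with
`m(i+1) > m i + 4`, `a(m(i+1) - 2) ≤ τ·a(m i + 2)` and minimality (`τ·a(m i + 2) < a(ℓ - 2)` for
`m i + 4 < ℓ < m(i+1)`); BLOCK MAXIMA (`BlockMax sh W m μ`) are numbers `μ i ≥ 0` dominating the shares
of the windowed scales of block `i` and attained by one of them unless `0`.  This file: block arithmetic;
ANCESTOR CHAINS bound every share by block maxima with a factor `32·4^{-(i-i')}` per block crossed plus a
summable boundary term (`harvest_share_le_blockMax`); FLAT-BLOCK ACCOUNTING (`harvest_block_accounting`):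
inside a block the τ-flat scales split into a subcritical run (shares grow geometrically with ratio 4,
total `≤ 2τ⁻²·` its top) and SATURATED scales (share `> τ²/1216`), so the block's shares are dominated by
six exceptional scales plus the saturated ones.  Sequel: `…AbstractHarvestCases` (unboundedness of the
block maxima).  Pure real analysis; no lattice object occurs.
-/

noncomputable section

open Finset Filter
open scoped BigOperators

namespace Summit.CriticalPhenomena.Ising3DConformalLimit.RungOneAdjacentMergingDominantShell

/-- A BLOCK SEQUENCE for the decay factor `τ`: the greedy chain of the decay-separation relation
`a(ℓ-2) ≤ τ·a(k+2)` started at some `m 0 ≥ 10`. [folklore] -/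
structure Blocks (a : ℕ → ℝ) (τ : ℝ) (m : ℕ → ℕ) : Prop where
  start : 10 ≤ m 0
  step : ∀ i, m i + 4 < m (i + 1)
  compat : ∀ i, a (m (i + 1) - 2) ≤ τ * a (m i + 2)
  minimal : ∀ i ℓ, m i + 4 < ℓ → ℓ < m (i + 1) → τ * a (m i + 2) < a (ℓ - 2)

/-- BLOCK MAXIMA of the share `sh` over the windowed (`W`) scales of the blocks of `m`. [folklore] -/
structure BlockMax (sh : ℕ → ℝ) (W : ℕ → Prop) (m : ℕ → ℕ) (μ : ℕ → ℝ) : Prop where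
  nonneg : ∀ i, 0 ≤ μ i
  ub : ∀ i k, m i ≤ k → k < m (i + 1) → W k → sh k ≤ μ i
  wit : ∀ i, μ i = 0 ∨ ∃ k, m i ≤ k ∧ k < m (i + 1) ∧ W k ∧ sh k = μ i

variable {a B : ℕ → ℝ} {sh : ℕ → ℝ} {W : ℕ → Prop} {τ : ℝ} {m : ℕ → ℕ} {μ : ℕ → ℝ}

/-! ### Block arithmetic -/

/-- Blocks have length at least five: `m j ≥ m i + 5 (j - i)` for `i ≤ j`. [folklore] -/
theorem Blocks.le_add (hm : Blocks a τ m) {i j : ℕ} (hij : i ≤ j) : m i + 5 * (j - i) ≤ m j := by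
  induction j, hij using Nat.le_induction with
  | base => simp
  | succ j _ ih =>
      have h1 := hm.step j
      omega

/-- `m` is strictly increasing. [folklore] -/
theorem Blocks.lt_of_lt (hm : Blocks a τ m) {i j : ℕ} (hij : i < j) : m i < m j := by
  have := hm.le_add hij.le
  omega

/-- `m` is monotone. [folklore] -/
theorem Blocks.le_of_le (hm : Blocks a τ m) {i j : ℕ} (hij : i ≤ j) : m i ≤ m j := by
  rcases hij.lt_or_eq with h | rfl
  · exact (hm.lt_of_lt h).le
  · exact le_rfl

/-- `m i ≥ m 0 + 5 i ≥ i`. [folklore] -/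
theorem Blocks.self_le (hm : Blocks a τ m) (i : ℕ) : m 0 + 5 * i ≤ m i := by
  simpa using hm.le_add (Nat.zero_le i)

/-- Every `k ≥ m 0` lies in a unique block: `m i ≤ k < m (i+1)` for some `i`. [folklore] -/
theorem Blocks.exists_block (hm : Blocks a τ m) {k : ℕ} (hk : m 0 ≤ k) : ∃ i, m i ≤ k ∧ k < m (i + 1) := by
  induction k with
  | zero =>
      refine ⟨0, hk, ?_⟩
      have := hm.step 0; omega
  | succ k ih =>
      by_cases hk0 : m 0 ≤ k
      · obtain ⟨i, hi1, hi2⟩ := ih hk0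
        by_cases hk1 : k + 1 < m (i + 1)
        · exact ⟨i, by omega, hk1⟩
        · refine ⟨i + 1, by omega, ?_⟩
          have := hm.step (i + 1); omega
      · refine ⟨0, hk, ?_⟩
        have := hm.step 0; omega

/-- Block indices are ordered like their elements. [folklore] -/
theorem Blocks.index_le (hm : Blocks a τ m) {i i' w k : ℕ} (hw : m i' ≤ w) (hk : k < m (i + 1))
    (hwk : w ≤ k) : i' ≤ i := by
  by_contra hcon
  push Not at hcon
  have h2 := hm.le_of_le (show i + 1 ≤ i' by omega)
  omega

/-- Block distance versus index distance: if `w` is in block `i'`, `k` in block `i`, and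
`w ≤ k ≤ w + 6 s`, then `i - i' ≤ 2 s + 1`. [folklore] -/
theorem Blocks.sub_le (hm : Blocks a τ m) {i i' w k s : ℕ} (hw2 : w < m (i' + 1))
    (hk1 : m i ≤ k) (hks : k ≤ w + 6 * s) : i - i' ≤ 2 * s + 1 := by
  by_cases hii : i ≤ i' + 1
  · omega
  · push Not at hii
    have h5 := hm.le_add (show i' + 1 ≤ i by omega)
    omega

/-! ### Ancestor chains -/

/-- ANCESTOR CHAIN: every scale `k ≥ m 0` has an ancestor `w ∈ [m 0, k]` with `k ≤ w + 6 s` and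
`sh k ≤ 32^{-s}·sh w`, which is windowed unless it lies in `[m 0, m 0 + 6)`. [folklore] -/
theorem harvest_chain (h : HarvestData a B) (hsh : ∀ k, sh k = 8 ^ k * a (k + 2) ^ 2 / B (k + 1))
    (hW : ∀ k, W k ↔ a (k - 4) ≤ (2 : ℝ) ^ 128 * a (k + 4)) (hm : Blocks a τ m) :
    ∀ k, m 0 ≤ k → ∃ s w, m 0 ≤ w ∧ w ≤ k ∧ k ≤ w + 6 * s ∧
      sh k ≤ (1 / 32) ^ s * sh w ∧ (W w ∨ w < m 0 + 6) := by
  intro k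
  induction k using Nat.strong_induction_on with
  | _ k ih =>
    intro hk
    by_cases hWk : W k
    · exact ⟨0, k, hk, le_rfl, by omega, by simp, Or.inl hWk⟩
    by_cases hk6 : k < m 0 + 6
    · exact ⟨0, k, hk, le_rfl, by omega, by simp, Or.inr hk6⟩
    push Not at hk6
    have hstart := hm.start
    rw [hW] at hWk
    obtain ⟨k', hk'1, hk'2, hle⟩ := harvest_ancestor h hsh (show 6 ≤ k by omega) hWk
    obtain ⟨s, w, hw0, hwk, hks, hsw, hcase⟩ := ih k' hk'2 (by omega)
    refine ⟨s + 1, w, hw0, by omega, by omega, ?_, hcase⟩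
    calc sh k ≤ (1 / 32) * sh k' := hle
      _ ≤ (1 / 32) * ((1 / 32) ^ s * sh w) := mul_le_mul_of_nonneg_left hsw (by norm_num)
      _ = (1 / 32) ^ (s + 1) * sh w := by rw [pow_succ]; ring

/-- Powers: `32^{-s} ≤ 32 · 4^{-d}` when `d ≤ 2 s + 1`. [folklore] -/
theorem harvest_pow_le {s d : ℕ} (hd : d ≤ 2 * s + 1) :
    (1 / 32 : ℝ) ^ s ≤ 32 * (1 / 4) ^ d := by
  have h1 : (1 / 4 : ℝ) ^ (2 * s + 1) ≤ (1 / 4) ^ d :=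
    pow_le_pow_of_le_one (by norm_num) (by norm_num) hd
  have h2 : (1 / 32 : ℝ) ^ s ≤ (1 / 16) ^ s := pow_le_pow_left₀ (by norm_num) (by norm_num) s
  have h3 : (1 / 4 : ℝ) ^ (2 * s + 1) = (1 / 4) * (1 / 16) ^ s := by
    rw [pow_succ, pow_mul]; norm_num; ring
  have h4 : 0 ≤ (1 / 16 : ℝ) ^ s := by positivity
  nlinarith

/-- SHARES ARE DOMINATED BY BLOCK MAXIMA: a scale `k` of block `i` has
`sh k ≤ 32·Σ_{i'≤i} 4^{-(i-i')} μ i' + 20·4^{-i}` (ancestor chain + block distance; the boundary term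
accounts for chains ending in `[m 0, m 0 + 6)`). [folklore] -/
theorem harvest_share_le_blockMax (h : HarvestData a B)
    (hsh : ∀ k, sh k = 8 ^ k * a (k + 2) ^ 2 / B (k + 1))
    (hW : ∀ k, W k ↔ a (k - 4) ≤ (2 : ℝ) ^ 128 * a (k + 4)) (hm : Blocks a τ m)
    (hμ : BlockMax sh W m μ) {i k : ℕ} (hk1 : m i ≤ k) (hk2 : k < m (i + 1)) :
    sh k ≤ 32 * ∑ i' ∈ range (i + 1), (1 / 4 : ℝ) ^ (i - i') * μ i' + 20 * (1 / 4) ^ i := by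
  have hk0 : m 0 ≤ k := (hm.le_of_le (Nat.zero_le i)).trans hk1
  obtain ⟨s, w, hw0, hwk, hks, hsw, hcase⟩ := harvest_chain h hsh hW hm k hk0
  obtain ⟨i', hi'1, hi'2⟩ := hm.exists_block hw0
  have hii' : i' ≤ i := hm.index_le hi'1 hk2 hwk
  have hdist : i - i' ≤ 2 * s + 1 := hm.sub_le hi'2 hk1 hks
  have hpow := harvest_pow_le (s := s) hdist
  have hsum_nn : 0 ≤ ∑ i' ∈ range (i + 1), (1 / 4 : ℝ) ^ (i - i') * μ i' :=
    Finset.sum_nonneg fun j _ => mul_nonneg (by positivity) (hμ.nonneg j)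
  have hshw_nn : 0 ≤ sh w := harvest_share_nonneg h hsh w
  rcases hcase with hWw | hw6
  · -- windowed ancestor in block i'
    have hle : sh w ≤ μ i' := hμ.ub i' w hi'1 hi'2 hWw
    have hmem : i' ∈ range (i + 1) := Finset.mem_range.2 (by omega)
    have hsingle : (1 / 4 : ℝ) ^ (i - i') * μ i' ≤ ∑ j ∈ range (i + 1), (1 / 4 : ℝ) ^ (i - j) * μ j :=
      Finset.single_le_sum (fun j _ => mul_nonneg (pow_nonneg (by norm_num) _) (hμ.nonneg j)) hmem
    calc sh k ≤ (1 / 32) ^ s * sh w := hsw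
      _ ≤ (32 * (1 / 4) ^ (i - i')) * μ i' := mul_le_mul hpow hle hshw_nn (by positivity)
      _ = 32 * ((1 / 4) ^ (i - i') * μ i') := by ring
      _ ≤ 32 * ∑ j ∈ range (i + 1), (1 / 4 : ℝ) ^ (i - j) * μ j := by gcongr
      _ ≤ _ := le_add_of_nonneg_right (by positivity)
  · -- boundary ancestor: sh w ≤ 1/7 and i ≤ 2 s + 2
    have hstart := hm.start
    have hle : sh w ≤ 1 / 7 := harvest_share_le h hsh (by omega)
    have hi'le : i' ≤ 1 := by
      by_contra hcon
      push Not at hcon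
      have h2 := hm.le_of_le (show 2 ≤ i' by omega)
      have h02 : m 0 + 10 ≤ m 2 := by simpa using hm.le_add (show 0 ≤ 2 by omega)
      omega
    have hi : i ≤ 2 * s + 2 := by omega
    have hpow2 : (1 / 32 : ℝ) ^ s * (1 / 7) ≤ 20 * (1 / 4) ^ i := by
      have h1 : (1 / 4 : ℝ) ^ (2 * s + 2) ≤ (1 / 4) ^ i :=
        pow_le_pow_of_le_one (by norm_num) (by norm_num) hi
      have h2 : (1 / 32 : ℝ) ^ s ≤ (1 / 16) ^ s := pow_le_pow_left₀ (by norm_num) (by norm_num) s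
      have h3 : (1 / 4 : ℝ) ^ (2 * s + 2) = (1 / 16) * (1 / 16) ^ s := by
        rw [pow_add, pow_mul]; norm_num; ring
      have h4 : 0 ≤ (1 / 16 : ℝ) ^ s := by positivity
      nlinarith
    calc sh k ≤ (1 / 32) ^ s * sh w := hsw
      _ ≤ (1 / 32) ^ s * (1 / 7) := mul_le_mul_of_nonneg_left hle (by positivity)
      _ ≤ 20 * (1 / 4) ^ i := hpow2
      _ ≤ _ := le_add_of_nonneg_left (by positivity)

/-! ### Inside one block: subcritical run and saturated scales -/

/-- Ratio-four geometric sums: if `0 ≤ x` and `4·x t ≤ x (t+1)` for `t + 1 < j` then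
`Σ_{t<j} x t ≤ (4/3)·x (j-1)` (`j ≥ 1`). [folklore] -/
theorem harvest_geom_four {x : ℕ → ℝ} (hx0 : ∀ t, 0 ≤ x t) :
    ∀ j, 1 ≤ j → (∀ t, t + 1 < j → 4 * x t ≤ x (t + 1)) → ∑ t ∈ range j, x t ≤ (4 / 3) * x (j - 1) := by
  intro j hj
  induction j, hj using Nat.le_induction with
  | base => intro _; have := hx0 0; simp; linarith
  | succ j hj ih =>
      intro hstep
      rw [Finset.sum_range_succ, show j + 1 - 1 = j by omega]
      have h1 := ih fun t ht => hstep t (by omega)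
      have h2 := hstep (j - 1) (by omega)
      rw [show j - 1 + 1 = j by omega] at h2
      linarith

set_option maxHeartbeats 400000 in
/-- FLAT-BLOCK ACCOUNTING: the shares of a block are dominated, up to the factor `1 + 2τ⁻²`, by the
shares of at most six exceptional scales (block start, top of the subcritical run, four tail scales)
plus the shares of the SATURATED flat scales (share `> τ²/1216`). [folklore] -/
theorem harvest_block_accounting (h : HarvestData a B)
    (hsh : ∀ k, sh k = 8 ^ k * a (k + 2) ^ 2 / B (k + 1)) (hτ : 0 < τ) (hτ1 : τ ≤ 1 / 2)
    (hm : Blocks a τ m) (i : ℕ) :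
    ∃ E : Finset ℕ, E ⊆ Ico (m i) (m (i + 1)) ∧ E.card ≤ 6 ∧
      ∑ k ∈ Ico (m i) (m (i + 1)), sh k ≤ (1 + 2 / τ ^ 2) *
        (∑ k ∈ E, sh k +
          ∑ k ∈ (Ico (m i) (m (i + 1) - 4)).filter (fun k => τ ^ 2 / 1216 < sh k), sh k) := by
  classical
  set p := m i with hp
  set q := m (i + 1) with hq
  have hpq : p + 4 < q := hm.step i
  have hp10 : 10 ≤ p := hm.start.trans (hm.le_of_le (Nat.zero_le i))
  have hnn := harvest_share_nonneg h hsh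
  have hτ2 : 0 < τ ^ 2 := by positivity
  -- the flat level a⋆ = a(q-3) and its key inequality τ·a(p+2) < a(q-3)
  have hflat : τ * a (p + 2) < a (q - 3) := by
    by_cases hq5 : q = p + 5
    · rw [hq5, show p + 5 - 3 = p + 2 by omega]
      have := h.a_pos (p + 2); nlinarith
    · have := hm.minimal i (q - 1) (by omega) (by omega)
      rwa [show q - 1 - 2 = q - 3 by omega] at this
  have hapos := h.a_pos
  -- squares: τ² a(k+2)² < a(q-3)² for k ≥ p
  have hsq : ∀ k, p ≤ k → τ ^ 2 * a (k + 2) ^ 2 ≤ a (q - 3) ^ 2 := by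
    intro k hk
    have h1 : a (k + 2) ≤ a (p + 2) := h.a_anti (by omega)
    have h2 : 0 ≤ τ * a (k + 2) := mul_nonneg hτ.le (hapos _).le
    have h3 : τ * a (k + 2) ≤ τ * a (p + 2) := mul_le_mul_of_nonneg_left h1 hτ.le
    nlinarith
  -- φ and the share sandwich on the flat part
  set φ : ℕ → ℝ := fun k => 8 ^ k * a (q - 3) ^ 2 / B (k + 1) with hφ
  have hφnn : ∀ k, 0 ≤ φ k := fun k =>
    div_nonneg (mul_nonneg (by positivity) (sq_nonneg _)) (harvest_B_pos h _).le
  have hD : ∀ k, p ≤ k → sh k ≤ φ k / τ ^ 2 := by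
    intro k hk
    rw [hsh, le_div_iff₀ hτ2, hφ]
    simp only
    rw [div_mul_eq_mul_div, div_le_div_iff_of_pos_right (harvest_B_pos h _)]
    have := hsq k hk
    have h8 : 0 ≤ (8 : ℝ) ^ k := by positivity
    nlinarith
  have hE : ∀ k, k + 2 ≤ q - 3 → φ k ≤ sh k := by
    intro k hk
    rw [hsh, hφ]
    simp only
    apply div_le_div_of_nonneg_right _ (harvest_B_pos h _).le
    apply mul_le_mul_of_nonneg_left _ (by positivity)
    exact pow_le_pow_left₀ (hapos _).le (h.a_anti hk) 2
  -- the subcriticality predicate and its dynamics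
  have hA : ∀ k, p + 1 ≤ k → τ ^ 2 * (B (k + 2) - B (k + 1)) ≤ 1216 * 8 ^ k * a (q - 3) ^ 2 := by
    intro k hk
    have hu := h.shell_upper (k + 2) (by omega)
    rw [show k + 2 - 1 = k + 1 by omega] at hu
    have h1 := hsq (k - 1) (by omega)
    rw [show k - 1 + 2 = k + 1 by omega] at h1
    have h8 : (8 : ℝ) ^ (k + 2) = 64 * 8 ^ k := by rw [pow_add]; ring
    rw [h8] at hu
    have h8' : 0 ≤ (8 : ℝ) ^ k := by positivity
    nlinarith
  have hB' : ∀ k, p + 1 ≤ k → 1216 * 8 ^ k * a (q - 3) ^ 2 ≤ τ ^ 2 * B (k + 1) →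
      4 * φ k ≤ φ (k + 1) := by
    intro k hk hsub
    have h1 := hA k hk
    have h2 : B (k + 2) ≤ 2 * B (k + 1) := by nlinarith
    have hB1 := harvest_B_pos h (k + 1)
    have hB2 := harvest_B_pos h (k + 2)
    simp only [hφ]
    have ha2 : 0 ≤ a (q - 3) ^ 2 := sq_nonneg _
    have h8 : 0 ≤ (8 : ℝ) ^ k := by positivity
    have h8s : (8 : ℝ) ^ (k + 1) = 8 * 8 ^ k := by rw [pow_succ]; ring
    rw [h8s, show k + 1 + 1 = k + 2 by omega, mul_div_assoc', div_le_div_iff₀ hB1 hB2]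
    have hX : 0 ≤ (8 : ℝ) ^ k * a (q - 3) ^ 2 := mul_nonneg h8 ha2
    have hkey := mul_le_mul_of_nonneg_left h2 hX
    nlinarith
  have hC : ∀ k, ¬ 1216 * 8 ^ k * a (q - 3) ^ 2 ≤ τ ^ 2 * B (k + 1) → τ ^ 2 / 1216 < φ k := by
    intro k hk
    push Not at hk
    simp only [hφ]
    rw [lt_div_iff₀ (harvest_B_pos h _), div_mul_eq_mul_div, div_lt_iff₀ (by norm_num : (0:ℝ) < 1216)]
    linarith
  have hiv : ∀ k, p + 1 ≤ k → ¬ 1216 * 8 ^ k * a (q - 3) ^ 2 ≤ τ ^ 2 * B (k + 1) →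
      ¬ 1216 * 8 ^ (k + 1) * a (q - 3) ^ 2 ≤ τ ^ 2 * B (k + 1 + 1) := by
    intro k hk hns
    push Not at hns ⊢
    have h1 := hA k hk
    have h8s : (8 : ℝ) ^ (k + 1) = 8 * 8 ^ k := by rw [pow_succ]; ring
    rw [show k + 1 + 1 = k + 2 by omega, h8s]
    have hX : 0 ≤ (8 : ℝ) ^ k * a (q - 3) ^ 2 := mul_nonneg (by positivity) (sq_nonneg _)
    nlinarith
  -- the subcritical run [p+1, p+1+j)
  have hex : ∃ j, ¬ (p + 1 + j ≤ q - 5 ∧ 1216 * 8 ^ (p + 1 + j) * a (q - 3) ^ 2 ≤ τ ^ 2 * B (p + 1 + j + 1)) :=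
    ⟨q, by omega⟩
  obtain ⟨j, hjspec, hjmin⟩ : ∃ j, ¬ (p + 1 + j ≤ q - 5 ∧
      1216 * 8 ^ (p + 1 + j) * a (q - 3) ^ 2 ≤ τ ^ 2 * B (p + 1 + j + 1)) ∧
      ∀ t, t < j → (p + 1 + t ≤ q - 5 ∧
        1216 * 8 ^ (p + 1 + t) * a (q - 3) ^ 2 ≤ τ ^ 2 * B (p + 1 + t + 1)) := by
    refine ⟨Nat.find hex, Nat.find_spec hex, fun t ht => ?_⟩
    have := Nat.find_min hex ht
    push Not at this
    exact this
  have hjle : p + 1 + j ≤ q - 4 := by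
    by_contra hcon
    have : q - 4 - (p + 1) < j := by omega
    have := (hjmin _ this).1
    omega
  -- the exceptional set
  refine ⟨{p, p + j, q - 4, q - 3, q - 2, q - 1}, ?_, ?_, ?_⟩
  · intro k hk
    simp only [Finset.mem_insert, Finset.mem_singleton] at hk
    rw [Finset.mem_Ico]; omega
  · exact (Finset.card_le_six)
  -- the sum decomposition
  have hsplit : ∑ k ∈ Ico p q, sh k = ∑ k ∈ Ico p (p + 1), sh k + ∑ k ∈ Ico (p + 1) (p + 1 + j), sh k +
      ∑ k ∈ Ico (p + 1 + j) (q - 4), sh k + ∑ k ∈ Ico (q - 4) q, sh k := by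
    rw [Finset.sum_Ico_consecutive _ (by omega : p ≤ p + 1) (by omega : p + 1 ≤ p + 1 + j),
      Finset.sum_Ico_consecutive _ (by omega : p ≤ p + 1 + j) hjle,
      Finset.sum_Ico_consecutive _ (by omega : p ≤ q - 4) (by omega : q - 4 ≤ q)]
  set SE := ∑ k ∈ ({p, p + j, q - 4, q - 3, q - 2, q - 1} : Finset ℕ), sh k with hSE
  set SS := ∑ k ∈ (Ico p (q - 4)).filter (fun k => τ ^ 2 / 1216 < sh k), sh k with hSS
  have hSEnn : 0 ≤ SE := Finset.sum_nonneg fun k _ => hnn k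
  have hSSnn : 0 ≤ SS := Finset.sum_nonneg fun k _ => hnn k
  -- (1) start + tail
  have h1 : ∑ k ∈ Ico p (p + 1), sh k + ∑ k ∈ Ico (q - 4) q, sh k ≤ SE := by
    have hdisj : Disjoint (Ico p (p + 1)) (Ico (q - 4) q) := by
      rw [Finset.disjoint_left]; intro k hk1 hk2; rw [Finset.mem_Ico] at hk1 hk2; omega
    rw [← Finset.sum_union hdisj, hSE]
    apply Finset.sum_le_sum_of_subset_of_nonneg _ (fun k _ _ => hnn k)
    intro k hk
    simp only [Finset.mem_union, Finset.mem_Ico, Finset.mem_insert, Finset.mem_singleton] at hk ⊢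
    omega
  -- (2) subcritical run
  have h2 : ∑ k ∈ Ico (p + 1) (p + 1 + j), sh k ≤ (2 / τ ^ 2) * SE := by
    rcases Nat.eq_zero_or_pos j with hj0 | hj0
    · rw [hj0, add_zero, Finset.Ico_self, Finset.sum_empty]; positivity
    rw [Finset.sum_Ico_eq_sum_range, show p + 1 + j - (p + 1) = j by omega]
    have hgeom := harvest_geom_four (x := fun t => φ (p + 1 + t)) (fun t => hφnn _) j hj0 (by
      intro t ht
      have := hB' (p + 1 + t) (by omega) (hjmin t (by omega)).2
      rwa [show p + 1 + t + 1 = p + 1 + (t + 1) by omega] at this)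
    have htop : φ (p + 1 + (j - 1)) ≤ sh (p + j) := by
      rw [show p + 1 + (j - 1) = p + j by omega]
      apply hE
      have := (hjmin (j - 1) (by omega)).1
      omega
    have hmem : sh (p + j) ≤ SE := by
      rw [hSE]
      apply Finset.single_le_sum (fun k _ => hnn k)
      simp
    calc ∑ t ∈ range j, sh (p + 1 + t) ≤ ∑ t ∈ range j, φ (p + 1 + t) / τ ^ 2 :=
          Finset.sum_le_sum fun t _ => hD _ (by omega)
      _ = (∑ t ∈ range j, φ (p + 1 + t)) / τ ^ 2 := by rw [Finset.sum_div]
      _ ≤ ((4 / 3) * φ (p + 1 + (j - 1))) / τ ^ 2 := div_le_div_of_nonneg_right hgeom hτ2.le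
      _ ≤ ((4 / 3) * SE) / τ ^ 2 := by gcongr; exact htop.trans hmem
      _ ≤ (2 / τ ^ 2) * SE := by
          rw [div_le_iff₀ hτ2]; field_simp; nlinarith
  -- (3) saturated run
  have h3 : ∑ k ∈ Ico (p + 1 + j) (q - 4), sh k ≤ SS := by
    have hsat : ∀ k, p + 1 + j ≤ k → k ≤ q - 5 →
        ¬ 1216 * 8 ^ k * a (q - 3) ^ 2 ≤ τ ^ 2 * B (k + 1) := by
      intro k hk
      induction k, hk using Nat.le_induction with
      | base => intro hk5; exact fun hsub => hjspec ⟨hk5, hsub⟩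
      | succ k hk ih => intro hk5; exact hiv k (by omega) (ih (by omega))
    rw [hSS]
    apply Finset.sum_le_sum_of_subset_of_nonneg _ (fun k _ _ => hnn k)
    intro k hk
    rw [Finset.mem_Ico] at hk
    rw [Finset.mem_filter, Finset.mem_Ico]
    refine ⟨by omega, ?_⟩
    exact (hC k (hsat k hk.1 (by omega))).trans_le (hE k (by omega))
  -- assemble
  rw [hsplit]
  have : (1 + 2 / τ ^ 2) * (SE + SS) = SE + (2 / τ ^ 2) * SE + SS + (2 / τ ^ 2) * SS := by ring
  rw [this]
  have h4 : 0 ≤ (2 / τ ^ 2) * SS := by positivity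
  linarith

/-- FLAT-BLOCK ACCOUNTING, self-contained form (registered sub-goal of the crux item). [folklore] -/
theorem harvest_blockAccounting : ∀ (a B sh : ℕ → ℝ) (τ : ℝ) (m : ℕ → ℕ), HarvestData a B → (∀ k, sh k = 8 ^ k * a (k + 2) ^ 2 / B (k + 1)) → 0 < τ → τ ≤ 1 / 2 → Blocks a τ m → ∀ i : ℕ, ∃ E : Finset ℕ, E ⊆ Finset.Ico (m i) (m (i + 1)) ∧ E.card ≤ 6 ∧ ∑ k ∈ Finset.Ico (m i) (m (i + 1)), sh k ≤ (1 + 2 / τ ^ 2) * (∑ k ∈ E, sh k + ∑ k ∈ (Finset.Ico (m i) (m (i + 1) - 4)).filter (fun k => τ ^ 2 / 1216 < sh k), sh k) :=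
  fun _ _ _ _ _ h hsh hτ hτ1 hm i => harvest_block_accounting h hsh hτ hτ1 hm i

end Summit.CriticalPhenomena.Ising3DConformalLimit.RungOneAdjacentMergingDominantShell

end
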